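import Literature.MathematicalPhysics.QuantumFieldTheory.Balaban1983to89.B7
import Literature.MathematicalPhysics.QuantumFieldTheory.Balaban1983to89.B7Eq123General

/-!
# `Balaban1983to89.B7ConclOneStep` — T. Bałaban, *Averaging operations for lattice gauge theories*, Commun. Math. Phys. **98**
(1985) 17–51 [Balaban1985Averaging]: **the abstract one-step carrier `B7.OneStep` of `B7.lean` INSTANTIATED on the concrete `ℤᵈ`
objects of the lineage WITH GENUINE PROPOSITION-3 FIELDS, and the decls of record `B7.Prop1Printed` (Prop. 1 (51) p. 26) and
`B7.Prop3Printed` (Prop. 3 (121)–(123) p. 36) PROVED for this ONE family** (model instance, the shape `B7.Concl` consumes: ONE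
`one : I₁ → OneStep` serving both `p1` and `p3`).

statement-level skeleton of published theorems with citation tags; proofs where landed; nothing here is a claim about the Yang–Mills mass gap

CITATION HEADER (lean-in-tree rule).  Cell `lit-balaban`, unit `lit-balaban-r04` (owner of block B7, gen 6).  MODEL-INSTANCE file for
SKELETON rows `B7.Prop1` (decl of record `B7.Prop1Printed`) and `B7.Prop3` (decl of record `B7.Prop3Printed`, abstract carrier
`B7.OneStep`; kernels `B7Prop3Flat.prop3_flat`, `B7Eq123General.norm_Ccov_le(_of_pdev)` (123) @gen [p06], `B7Prop3GeneralAnalytic.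
prop3_general_analyticAt(_of_le_c3)` (121) @gen).  WHY THIS FILE: the only `B7.OneStep` family in the tree, `B7Prop1Explicit.concreteOneStep`,
sets the Prop.-3 fields to trivial values (`Fld := Unit`, `IsAnalyticQ := True`, `remC := 0`, by design — it serves Prop. 1 only), so
`B7.Prop3Printed` over it holds VACUOUSLY; the leaf `B7.Concl` of `B7.lean` (and `DagDischargedII.B7LeafRest`) feed `p1` AND `p3` from the
SAME family.  Here the family carries the genuine objects: `remC V₀ A = ‖C(V₀, A, c)‖` (`B7Prop3GeneralLinear.Ccov`, (122)),
`IsAnalyticQ V₀ r` = «`Q(V₀, A, c) = (1/i) log V̿₁(c)` (`B7Prop3GeneralLinear.Qcov`, (121)) is analytic in the bond variables `A_b` on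
the polydisc `|A_b| < r`», `fldNorm A = sup_b‖A_b‖`, and BOTH printed propositions are theorems for it.

PRINT.  Prop. 1 p. 26: "There exist positive constants `C₀, c′₂` such that for every configuration `V` satisfying (44) for `p ⊂ Δ(p′)`
and for `α₀ ≦ c′₂`, we have `|V̄(∂p′) − 1| < L²α₀ + C₀(L²α₀)²` (51). The constant `C₀` depends on `d` and `c′₂` depends on `d` and `L`."
Prop. 3 p. 36: "There exist constants `C₁, c₃, c₃ ≦ c₂`, such that for `α₀, α₁ ≦ c₃` the function `Q(V₀, A) = (1/i) log V̄₁` is an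
analytic function of `A` satisfying the equalities and bounds (122)–(124). The constant `C₁` depends on `d` and `c₃` depends on `d` and
`L`."  (122) `Q(V₀, A, c) = L(Q(V₀)A)_c + C(V₀, A, c)`, (123) `|C(V₀, A, c)| ≦ C₁L²|A|² < C₁(Lα₁)²`; hypotheses (109) p. 34:
`|V₀(∂p) − 1| < α₀`, `V_{1,b} = e^{iA_b}`, `|A_b| < α₁`, `A_b ∈ 𝔤ᶜ`.

THE FAMILY `concreteOneStepBD 𝔸 L` (index `i = (p′, c)`: a plaquette `p′ = (z; μ ≠ ν)` of the `L`-lattice — Prop. 1's (51) — and an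
`L`-bond `c = ⟨q, q + Le_κ⟩` — Prop. 3's (121)–(123); both configuration-independent data for fixed `d`, `L`, as the family
convention D-pv14.2 of `B7.lean` prescribes): `Cfg` = configurations `ℤᵈ → (Fin d → 𝔸ˣ)` with values in `U1 𝔸 = {|u| ≤ 1, |u⁻¹| ≤ 1}`
(⊇ `U(N)`; the lineage's reading of «`G`-valued»); `Fld` = BOUNDED `𝔸`-valued bond fields (𝔤ᶜ-valued in print; the `i` of `e^{iA}`
absorbed, lineage convention `V₁ = expCfg A`); `plaqDev V = pdev V = sup_p‖V(∂p) − 1‖` over ALL unit plaquettes (⊇ «`p ⊂ Δ(p′)`»,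
(44)/(109)); `avgDev V = ‖V̄(∂p′) − 1‖` for the average (42) (`cplaq L (bavg L V)`); `fldNorm A = sup_b‖A_b‖`; `IsAnalyticQ V₀ r` =
for every finite set `S` of bonds, `(A_b)_{b∈S} ↦ Q(V₀, A, c)` (`A = a` on `S`, `0` off `S`: `B7Prop3Flat.insCfg`) is analytic on a
neighbourhood of every point of the open polydisc `{∀ b, ‖A_b‖ < r}` (print: "analytic function of `A`", the variables being the
`A_b`, `b ⊂ B(c₋) ∪ B(c₊)`, p. 34 — every finite `S` is admitted); `remC V₀ A = ‖Ccov L V₀ A c‖`.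

WHAT THIS FILE PROVES (kernel, no `sorry`, standard axioms).
* `prop1Printed_BD (hL : 1 ≤ L) : B7.Prop1Printed L (concreteOneStepBD 𝔸 L)` — `C₀ = 14464(d+1)²(d+4)²`, `c₂′ = 1/(512(d+1)(d+4)L²)`
  (the witnesses of `B7Prop1Explicit.prop1Printed_concrete`; proof = that proof, through `B7Prop1Explicit.prop1_explicit`).
* `prop3Printed_BD (hL : 1 ≤ L) (hc₂ : 0 < c₂) : B7.Prop3Printed L c₂ (concreteOneStepBD 𝔸 L)` — `C₁ = 131072(d+1)²` (depends on
  `d` only), `c₃ = min{c₂, 1/(1024(d+1)(d+4)L²), c₃(d,L)}` (`c₃(d,L) = B7Prop3Flat.c3 d L = 1/(128(d+1)L)`; depends on `d`, `L`, and is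
  `≤ c₂` as printed): the analyticity clause from `B7Prop3GeneralAnalytic.prop3_general_analyticAt_of_le_c3`, (123) from
  `B7Eq123General.norm_Ccov_le_of_pdev`, the regularity of the block loops at `c` from `B7Eq123General.blockLoops_of_pdev`.
READINGS (located, inherited from the kernels): Banach-algebra carrier with `U1`-valued backgrounds (print: `U(N)`); `≤`/`<` as typed in
`B7.lean` (the typed `Prop3Printed` has `remC ≤ C₁L²|A|²`, print's first inequality of (123)); (122)'s linear part is the ray derivative
`B7Prop3GeneralLinear.linQcov` (its closed form (124) and bound (126) are `B7Prop3GeneralLinearBound`'s, not fields of the carrier).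
NOT CLAIMED: nothing beyond the two typed statements; the other eight conjuncts of `B7.Concl` are the business of the sibling files
`B7ConclKExp`, `B7ConclGauge`, `B7ConclConcrete` of this unit.
DECLARATIONS: 2 structures/defs (`Idx`, `BddFld`), 1 carrier family, theorems.  Unit `lit-balaban-r04` (gen 6), 2026-08-21.

[cite: Balaban1985Averaging, Proposition 1 (51) p.26, Proposition 3 (121)–(123) p.36, (109) p.34, (44) p.24]
-/

noncomputable section

open scoped BigOperators
open NormedSpace

namespace Literature.MathematicalPhysics.QuantumFieldTheory.Balaban1983to89.B7ConclOneStep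

open B7Prop1Explicit B7Prop2Explicit B7Prop3Flat B7Eq92Concrete MatrixLog B7Prop3GeneralLinear B7Prop3GeneralAnalytic
  B7Eq123General

-- `Site` alone would resolve to the torus sites of `Setup.lean`; re-export the `ℤ^d` sites of `B7Prop1Explicit`.
export B7Prop1Explicit (Site)

variable {d : ℕ}

/-! ## §1 The index and the field type -/

/-- The family index of the one-step carrier: a plaquette `p′ = (z; μ, ν)`, `μ ≠ ν`, of the `L`-lattice (lower-left corner `z`;
the conclusion (51) of Prop. 1 is read at `p′`) and a bond `c = ⟨q, q + Le_κ⟩` of the `L`-lattice (the functions (121)–(123) of Prop. 3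
are read at `c`) — configuration-independent data for fixed `d`, `L` (family convention of `B7.lean`). [cite: Balaban1985Averaging, (51) p.26, (121) p.36] -/
structure Idx (d : ℕ) where
  /-- lower-left corner of the plaquette `p′` of the `L`-lattice -/
  z : Site d
  /-- first direction of `p′` -/
  μ : Fin d
  /-- second direction of `p′` -/
  ν : Fin d
  /-- `p′` is a genuine plaquette -/
  hμν : μ ≠ ν
  /-- starting point of the `L`-bond `c` -/
  q : Site d
  /-- direction of `c` -/
  κ : Fin d

/-- BOUNDED `𝔸`-valued bond fields on `ℤᵈ` — the perturbation fields `A` of (109) («`|A_b| < α₁`», so `sup_b|A_b|` is finite);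
the witness makes `sup_b‖A_b‖` a genuine supremum. [cite: Balaban1985Averaging, (109) p.34] -/
def BddFld (d : ℕ) (𝔸 : Type) [Norm 𝔸] : Type :=
  {A : Site d → Fin d → 𝔸 // BddAbove (Set.range fun b : Site d × Fin d => ‖A b.1 b.2‖)}

section Carrier

variable (𝔸 : Type) [NormedRing 𝔸] [NormOneClass 𝔸] [NormedAlgebra ℂ 𝔸] [CompleteSpace 𝔸]

/-- **The concrete one-step family of B7 Sects. B–D on `ℤᵈ` with genuine Proposition-3 fields** (see the module docstring for
every field): `Cfg` = `U1`-valued configurations, `Fld` = bounded fields, `plaqDev = pdev` ((44)/(109)), `avgDev V = ‖V̄(∂p′) − 1‖`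
((42), (51)), `fldNorm A = sup_b‖A_b‖`, `IsAnalyticQ V₀ r` = analyticity of `(A_b)_{b∈S} ↦ Q(V₀, A, c)` ((121), `Qcov`) on the polydisc of
radius `r` for every finite bond set `S`, `remC V₀ A = ‖C(V₀, A, c)‖` ((122), `Ccov`). [cite: Balaban1985Averaging, (42) p.23, (44) p.24, (109) p.34, (121)–(122) p.36] -/
def concreteOneStepBD (L : ℕ) (i : Idx d) : B7.OneStep where
  Cfg := {V : Site d → Fin d → 𝔸ˣ // ∀ x κ, V x κ ∈ U1 𝔸}
  Fld := BddFld d 𝔸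
  plaqDev V := pdev V.1
  avgDev V := ‖((cplaq L (bavg L V.1) i.z i.μ i.ν : 𝔸ˣ) : 𝔸) - 1‖
  fldNorm A := ⨆ b : Site d × Fin d, ‖A.1 b.1 b.2‖
  IsAnalyticQ V₀ r := ∀ S : Finset (Site d × Fin d),
    AnalyticOnNhd ℂ (fun a : S → 𝔸 => Qcov L V₀.1 (insCfg S a) i.q i.κ) {a | ∀ s, ‖a s‖ < r}
  remC V₀ A := ‖Ccov L V₀.1 A.1 i.q i.κ‖

end Carrier

section Props

variable {𝔸 : Type} [NormedRing 𝔸] [NormOneClass 𝔸] [NormedAlgebra ℂ 𝔸] [CompleteSpace 𝔸]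

omit [NormOneClass 𝔸] [NormedAlgebra ℂ 𝔸] [CompleteSpace 𝔸] in
/-- «|A|» = `sup_b|A_b|` ((19), (109)): every bond variable of a bounded field is bounded by its sup norm (`le_ciSup`) — bookkeeping
for the hypothesis «|A_b| < α₁» of (109). [cite: Balaban1985Averaging, (109) p.34, (19) p.21] -/
theorem norm_le_fldNorm (A : BddFld d 𝔸) (x : Site d) (κ : Fin d) :
    ‖A.1 x κ‖ ≤ ⨆ b : Site d × Fin d, ‖A.1 b.1 b.2‖ :=
  le_ciSup A.2 (x, κ)

omit [NormOneClass 𝔸] [NormedAlgebra ℂ 𝔸] [CompleteSpace 𝔸] in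
/-- «|A|» = `sup_b|A_b| ≥ 0` — bookkeeping for (109)/(123). [cite: Balaban1985Averaging, (109) p.34, (19) p.21] -/
theorem fldNorm_nonneg (A : BddFld d 𝔸) : 0 ≤ ⨆ b : Site d × Fin d, ‖A.1 b.1 b.2‖ :=
  Real.iSup_nonneg fun _ => norm_nonneg _

/-- **Proposition 1 (51) AS TYPED (`B7.Prop1Printed`) for the family `concreteOneStepBD`**, every `d`, every `L ≥ 1`, `𝔸` any complete
normed `ℂ`-algebra with `‖1‖ = 1`: witnesses `C₀ = 14464(d+1)²(d+4)²` (depends on `d`), `c₂′ = 1/(512(d+1)(d+4)L²)` (depends on `d`,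
`L`).  Proof = `B7Prop1Explicit.prop1_explicit` (hypothesis (44) at the intermediate `α₁ = (pdev V + α₀)/2 < α₀` to produce the printed
strict `<`). [cite: Balaban1985Averaging, Prop. 1 (51) p.26] -/
theorem prop1Printed_BD (L : ℕ) (hL : 1 ≤ L) :
    B7.Prop1Printed (L : ℝ) (concreteOneStepBD 𝔸 (d := d) L) := by
  refine ⟨226 * (8 * ((d : ℝ) + 1) * (d + 4)) ^ 2, 1 / (512 * ((d : ℝ) + 1) * (d + 4) * (L : ℝ) ^ 2),
    by positivity, by positivity, ?_⟩
  rintro ⟨z, μ, ν, hμν, q, κ₀⟩ α₀ hα₀ hc ⟨V, hV⟩ hdev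
  simp only [concreteOneStepBD] at hdev ⊢
  have hs0 : 0 ≤ pdev V := pdev_nonneg V
  -- an intermediate `α₁` with `pdev V < α₁ < α₀` gives the strict inequality (51)
  set α₁ := (pdev V + α₀) / 2 with hα₁
  have hα₁0 : 0 ≤ α₁ := by positivity
  have hα₁α₀ : α₁ < α₀ := by rw [hα₁]; linarith
  have hα₁α₀' : α₁ ≤ α₀ := hα₁α₀.le
  have h44 : ∀ (x : Site d) (κ κ' : Fin d), κ ≠ κ' → ‖((hol V x (plaqWord κ κ') : 𝔸ˣ) : 𝔸) - 1‖ ≤ α₁ := by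
    intro x κ κ' _
    have := le_pdev hV x κ κ'
    linarith
  have hsmall : 512 * (d + 1) * (d + 4) * (L : ℝ) ^ 2 * α₁ ≤ 1 := by
    have hpos : 0 < 512 * ((d : ℝ) + 1) * (d + 4) * (L : ℝ) ^ 2 := by positivity
    have h1 := (le_div_iff₀ hpos).mp hc
    have h2 := mul_le_mul_of_nonneg_left hα₁α₀' hpos.le
    linarith
  have hmain := prop1_explicit L hL z hμν V hV hα₁0 hsmall h44
  refine hmain.trans_lt ?_
  have hL2 : 0 < (L : ℝ) ^ 2 := by positivity
  have h1 : (L : ℝ) ^ 2 * α₁ < (L : ℝ) ^ 2 * α₀ := by gcongr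
  have h2 : (8 * ((d : ℝ) + 1) * (d + 4) * (L : ℝ) ^ 2 * α₁) ^ 2
      ≤ (8 * ((d : ℝ) + 1) * (d + 4) * (L : ℝ) ^ 2 * α₀) ^ 2 := by
    gcongr
  nlinarith

/-- **Proposition 3 (121)–(123) AS TYPED (`B7.Prop3Printed`) for the family `concreteOneStepBD`**, every `d`, every `L ≥ 1`, every
`c₂ > 0` (in `B7.Concl`: Prop. 2's `c₂ = min{1/(3C₀), ½c₂′}`), `𝔸` any complete normed `ℂ`-algebra with `‖1‖ = 1`: witnesses
`C₁ = 131072(d+1)²` («`C₁` depends on `d`») and `c₃ = min{c₂, 1/(1024(d+1)(d+4)L²), 1/(128(d+1)L)}` («`c₃ ≦ c₂`», «depends on `d` and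
`L`»).  For `V₀` with `sup_p‖V₀(∂p) − 1‖ < α₀ ≤ c₃`: the block loops at `c` are `1/64`-regular (`B7Eq123General.blockLoops_of_pdev`), so
(i) `A ↦ Q(V₀, A, c)` is analytic on the polydisc of radius `α₁ ≤ c₃(d,L)` in any finite set of bond variables
(`B7Prop3GeneralAnalytic.prop3_general_analyticAt_of_le_c3` along the insertion `B7Prop3Flat.insCfg`), and (ii) (123)
`‖C(V₀, A, c)‖ ≤ C₁L²(sup_b‖A_b‖)²` for `sup_b‖A_b‖ < α₁` (`B7Eq123General.norm_Ccov_le_of_pdev`). [cite: Balaban1985Averaging, Prop. 3 (121)–(123) p.36, (109) p.34] -/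
theorem prop3Printed_BD (L : ℕ) (hL : 1 ≤ L) {c₂ : ℝ} (hc₂ : 0 < c₂) :
    B7.Prop3Printed (L : ℝ) c₂ (concreteOneStepBD 𝔸 (d := d) L) := by
  refine ⟨131072 * ((d : ℝ) + 1) ^ 2,
    min c₂ (min (1 / (1024 * ((d : ℝ) + 1) * ((d : ℝ) + 4) * (L : ℝ) ^ 2)) (c3 d L)),
    by positivity, lt_min hc₂ (lt_min (by positivity) (c3_pos d hL)), min_le_left _ _, ?_⟩
  rintro ⟨z, μ, ν, hμν, q, κ⟩ α₀ α₁ hα₀ hα₀c hα₁ hα₁c ⟨V₀, hV₀⟩ hdev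
  simp only [concreteOneStepBD] at hdev ⊢
  have hβmax : α₀ ≤ 1 / (1024 * ((d : ℝ) + 1) * ((d : ℝ) + 4) * (L : ℝ) ^ 2) :=
    hα₀c.trans ((min_le_right _ _).trans (min_le_left _ _))
  have hα₁c3 : α₁ ≤ c3 d L := hα₁c.trans ((min_le_right _ _).trans (min_le_right _ _))
  obtain ⟨hreg, hα1⟩ := blockLoops_of_pdev hL hV₀ hα₀.le hdev hβmax q κ
  refine ⟨fun S => ?_, fun A hA => ?_⟩
  · -- the analyticity clause on the polydisc `{∀ b, ‖a_b‖ < α₁}`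
    intro a ha
    have hna : ‖a‖ < α₁ := (pi_norm_lt_iff hα₁).2 ha
    have h := prop3_general_analyticAt_of_le_c3 (fun a' : S → 𝔸 => insCfg S a')
      (fun x κ' => analyticAt_insCfg S x κ' a) hL hV₀ (norm_nonneg a) (fun x κ' => norm_insCfg_le S a x κ')
      (hna.le.trans hα₁c3) q κ hα1 hreg
    simpa only [Qcov] using h
  · -- (123)
    have ha0 := fldNorm_nonneg A
    have hAa := norm_le_fldNorm A
    exact norm_Ccov_le_of_pdev hL hV₀ hα₀.le hdev hβmax A.1 ha0 (fun x κ' => hAa x κ') (hA.le.trans hα₁c3) q κ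

/-- **Both one-step conjuncts of `B7.Concl` for ONE family**: `p1 ∧ p3` for `concreteOneStepBD 𝔸 L`, `L ≥ 1`, `c₂ > 0`.
[cite: Balaban1985Averaging, Prop. 1 (51) p.26, Prop. 3 (121)–(123) p.36] -/
theorem p1_and_p3_BD (L : ℕ) (hL : 1 ≤ L) {c₂ : ℝ} (hc₂ : 0 < c₂) :
    B7.Prop1Printed (L : ℝ) (concreteOneStepBD 𝔸 (d := d) L) ∧
      B7.Prop3Printed (L : ℝ) c₂ (concreteOneStepBD 𝔸 (d := d) L) :=
  ⟨prop1Printed_BD L hL, prop3Printed_BD L hL hc₂⟩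

end Props

end Literature.MathematicalPhysics.QuantumFieldTheory.Balaban1983to89.B7ConclOneStep

end
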